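import Literature.NumberTheory.EllipticCurves.X049TwistCMSigmaSqTwoProofs
import HarnessLib

/-!
# The integral twist models `W_k = [1, −(3k+1), 0, −2(4k+1)², −(4k+1)³]` of `49a1^{(4k+1)}`: global
# minimality for squarefree `4k + 1`, good reduction away from `7(4k+1)` (so at `2`), and the canonical
# `2`-adic height datum WITHOUT the minimality binder (proofs only)

Topic `NumberTheory/EllipticCurves` (theorems only; no definition, no named fact, no instance). Cell
`bsd-goldfeld`, typer seat `bsd-goldfeld-ty` g12: kernel hygiene for the consumers of
`X049TwistCMSigmaSqTwoProofs` §4 and of the `p = 2` Bertrand fact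
(`BertrandCMHeightNonvanishingTwo.lean`), which carry `[W.IsGloballyMinimal]` resp.
`W.HasGoodReductionAtPrime 2` as binders on the twist models `W_k`.

* `cm7Twist_discOf`, `cm7Twist_c4Of` — the tree-rechecked integers `Δ = −343(4k+1)⁶`,
  `c₄ = 105(4k+1)²` of `[1, −(3k+1), 0, −2(4k+1)², −(4k+1)³]` (`X11RankOneCertificates.Schema`).
* `cm7Twist_isGloballyMinimal_of_squarefree` — for SQUAREFREE `4k + 1` the model `W_k` is globally
  minimal: Silverman's criterion "`v_q(Δ) < 12` or `v_q(c₄) < 4` at every prime `q`" (tree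
  `isGloballyMinimal_of_int_criterion`), here through `v_q(c₄) = v_q(105) + 2v_q(4k+1) ≤ 3`.
* `cm7Twist_minimalDiscriminantInt` (`Δ_min = −343(4k+1)⁶`), `cm7Twist_hasGoodReductionAtPrime`
  (every prime `ℓ ∤ 7(4k+1)`), `cm7Twist_hasGoodReductionAtPrime_two` (`Δ_min` odd).
* `cm7Twist_existsUnique_isCanonicalSq_two_of_squarefree` — THE canonical `2`-adic height datum of
  `49a1^{(4k+1)}` on `W_k`, sigma-squared form, exists uniquely, for every squarefree `4k + 1`, with no
  instance binder beyond `[W.IsElliptic]` (tree `cm7Twist_existsUnique_isCanonicalSq_two`).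

## References
* [Silverman AEC] J. H. Silverman, *The Arithmetic of Elliptic Curves*, 2nd ed., VII.1 Remark 1.1,
  VIII.8 (global minimal models), X.5 (twists). [cite: SilvermanAEC2009, VII.1 Remark 1.1]
* [Mazur–Stein–Tate 2006] §2.7. [cite: MazurSteinTate2006, §2.7]
-/

noncomputable section

open WeierstrassCurve Literature.NumberTheory.EllipticCurves.Rank1Residual.X11RankOneCertificates

namespace Literature.NumberTheory.EllipticCurves

section TwistMinimal

variable (W : WeierstrassCurve ℚ) (k : ℤ)

/-- `Δ([1, −(3k+1), 0, −2(4k+1)², −(4k+1)³]) = −343·(4k+1)⁶` on the integer invariants of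
`X11RankOneCertificates.Schema`. [cite: SilvermanAEC2009, III.1] -/
theorem cm7Twist_discOf :
    discOf [1, -(3 * k + 1), 0, -2 * (4 * k + 1) ^ 2, -(4 * k + 1) ^ 3] = -343 * (4 * k + 1) ^ 6 := by
  simp only [discOf, invariants]
  ring

/-- `c₄([1, −(3k+1), 0, −2(4k+1)², −(4k+1)³]) = 105·(4k+1)²`. [cite: SilvermanAEC2009, III.1] -/
theorem cm7Twist_c4Of :
    c4Of [1, -(3 * k + 1), 0, -2 * (4 * k + 1) ^ 2, -(4 * k + 1) ^ 3] = 105 * (4 * k + 1) ^ 2 := by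
  simp only [c4Of, invariants]
  ring

/-- `105 = 3·5·7` is squarefree. [folklore] -/
private theorem squarefree_105 : Squarefree (105 : ℕ) := by
  rw [Nat.squarefree_iff_prime_squarefree]
  intro p hp h
  have hle : p * p ≤ 105 := Nat.le_of_dvd (by norm_num) h
  have hp10 : p ≤ 10 := by nlinarith [hp.two_le]
  interval_cases p <;> first | omega | norm_num at hp

/-- For squarefree `m` and a prime `q`, `q⁴ ∤ 105·m²` (`v_q(105 m²) ≤ 1 + 2 = 3`). [folklore] -/
private theorem not_pow_four_dvd (m : ℕ) (hm : Squarefree m) (q : ℕ) (hq : q.Prime) :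
    ¬ q ^ 4 ∣ 105 * m ^ 2 := by
  intro h
  have hm0 : m ≠ 0 := hm.ne_zero
  have hN : 105 * m ^ 2 ≠ 0 := mul_ne_zero (by norm_num) (pow_ne_zero 2 hm0)
  have h4 : 4 ≤ (105 * m ^ 2).factorization q := (hq.pow_dvd_iff_le_factorization hN).mp h
  rw [Nat.factorization_mul (by norm_num) (pow_ne_zero 2 hm0), Nat.factorization_pow] at h4
  simp only [Finsupp.coe_add, Finsupp.coe_smul, Pi.add_apply, Pi.smul_apply, smul_eq_mul] at h4
  have h105 := squarefree_105.natFactorization_le_one q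
  have hm1 := hm.natFactorization_le_one q
  omega

/-- **`W_k` is a global minimal model when `4k + 1` is squarefree** (`v_q(c₄) ≤ 3 < 4` at every prime:
Silverman *AEC* VII.1 Rem. 1.1 at every place; tree `isGloballyMinimal_of_int_criterion`). A THEOREM,
not an instance (use `haveI`). [cite: SilvermanAEC2009, VII.1 Remark 1.1] -/
theorem cm7Twist_isGloballyMinimal_of_squarefree
    (hW : W = ⟨1, -(3 * (k : ℚ) + 1), 0, -2 * (4 * (k : ℚ) + 1) ^ 2, -(4 * (k : ℚ) + 1) ^ 3⟩)
    (hsq : Squarefree (4 * k + 1)) : W.IsGloballyMinimal := by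
  have hmin := isGloballyMinimal_of_int_criterion 1 (-(3 * k + 1)) 0 (-2 * (4 * k + 1) ^ 2)
    (-(4 * k + 1) ^ 3) fun q hq ⟨_, hc⟩ => by
      rw [cm7Twist_c4Of] at hc
      have hc' : q ^ 4 ∣ 105 * (4 * k + 1).natAbs ^ 2 := by
        have := Int.natAbs_dvd_natAbs.mpr hc
        simpa [Int.natAbs_mul, Int.natAbs_pow] using this
      exact not_pow_four_dvd _ (Int.squarefree_natAbs.mpr hsq) q hq hc'
  have hW' : W = (⟨((1 : ℤ) : ℚ), ((-(3 * k + 1) : ℤ) : ℚ), ((0 : ℤ) : ℚ),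
      ((-2 * (4 * k + 1) ^ 2 : ℤ) : ℚ), ((-(4 * k + 1) ^ 3 : ℤ) : ℚ)⟩ : WeierstrassCurve ℚ) := by
    rw [hW]; push_cast; rfl
  rw [hW']
  exact hmin

/-- **Minimal discriminant of `W_k`** (any `W/ℚ` equal to it that is globally minimal):
`Δ_min = −343·(4k+1)⁶`. [cite: SilvermanAEC2009, VIII.8] -/
theorem cm7Twist_minimalDiscriminantInt [W.IsGloballyMinimal]
    (hW : W = ⟨1, -(3 * (k : ℚ) + 1), 0, -2 * (4 * (k : ℚ) + 1) ^ 2, -(4 * (k : ℚ) + 1) ^ 3⟩) :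
    minimalDiscriminantInt W = -343 * (4 * k + 1) ^ 6 := by
  have h := cast_minimalDiscriminantInt W
  rw [cm7Twist_Δ W k hW] at h
  exact_mod_cast h

/-- **`W_k` has good reduction at every prime `ℓ` not dividing `7(4k+1)`** (`ℓ ∤ Δ_min`; tree
`hasGoodReductionAtPrime_of_not_dvd`). [cite: SilvermanAEC2009, VII.1 Remark 1.1] -/
theorem cm7Twist_hasGoodReductionAtPrime [W.IsGloballyMinimal]
    (hW : W = ⟨1, -(3 * (k : ℚ) + 1), 0, -2 * (4 * (k : ℚ) + 1) ^ 2, -(4 * (k : ℚ) + 1) ^ 3⟩)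
    (ℓ : ℕ) [hℓ : Fact ℓ.Prime] (h7 : ℓ ≠ 7) (hd : ¬ (ℓ : ℤ) ∣ 4 * k + 1) :
    W.HasGoodReductionAtPrime ℓ := by
  refine hasGoodReductionAtPrime_of_not_dvd W ℓ ?_
  rw [cm7Twist_minimalDiscriminantInt W k hW]
  have hp : Prime (ℓ : ℤ) := Nat.prime_iff_prime_int.mp hℓ.out
  intro h
  rw [dvd_neg.symm, neg_mul, neg_neg] at h
  rcases hp.dvd_or_dvd h with h343 | h6
  · have h' : (ℓ : ℤ) ∣ 7 := hp.dvd_of_dvd_pow (by rw [show (343 : ℤ) = 7 ^ 3 by norm_num] at h343; exact h343)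
    have h'' : ℓ ∣ 7 := by exact_mod_cast h'
    exact h7 ((Nat.prime_dvd_prime_iff_eq hℓ.out (by norm_num)).mp h'')
  · exact hd (hp.dvd_of_dvd_pow h6)

/-- **`W_k` has good reduction at `2`** (`Δ_min = −343(4k+1)⁶` is odd). [cite: SilvermanAEC2009, VII.1 Remark 1.1] -/
theorem cm7Twist_hasGoodReductionAtPrime_two [W.IsGloballyMinimal]
    (hW : W = ⟨1, -(3 * (k : ℚ) + 1), 0, -2 * (4 * (k : ℚ) + 1) ^ 2, -(4 * (k : ℚ) + 1) ^ 3⟩) :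
    W.HasGoodReductionAtPrime 2 :=
  cm7Twist_hasGoodReductionAtPrime W k hW 2 (by decide) (by omega)

/-- **THE canonical `2`-adic height datum of `49a1^{(4k+1)}` on `W_k`, sigma-squared form, exists and is
unique for every squarefree `4k + 1`** — no minimality instance, no printed hypothesis (tree
`cm7Twist_existsUnique_isCanonicalSq_two` + `cm7Twist_isGloballyMinimal_of_squarefree`).
[cite: MazurSteinTate2006, §2.7] [cite: Perrinriou1984, Ch. III §1.2 Lemme 2] -/
theorem cm7Twist_existsUnique_isCanonicalSq_two_of_squarefree [W.IsElliptic]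
    (hW : W = ⟨1, -(3 * (k : ℚ) + 1), 0, -2 * (4 * (k : ℚ) + 1) ^ 2, -(4 * (k : ℚ) + 1) ^ 3⟩)
    (hsq : Squarefree (4 * k + 1)) : ∃! D : PAdicHeightData W 2, D.IsCanonicalSq := by
  haveI := cm7Twist_isGloballyMinimal_of_squarefree W k hW hsq
  exact cm7Twist_existsUnique_isCanonicalSq_two W k hW

end TwistMinimal

end Literature.NumberTheory.EllipticCurves
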